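import Summits.KontsevichZagierPeriods.KontsevichZagierPeriods.Theorems.RootDecompQuadraticDescentPair18HomotopyGridP4

/-! # `RootDecompQuadraticDescentPair18HomotopyGridP5` — part 5/5 of the mechanical ≤400-line split of `Grid_landing.lean` (sha256 c1ef4f0ae5c58233…)
Source: decomp-kz lens-6 g10 `Pair18HomotopyGrid.lean` (file #4; HOME/decomp-kz-lens-6/g10/, sha256 f97d8f44…; critic g5-19 CLEARED «census pair #18 = THEOREM, no hypothesis left»): hGrid_of_charts (hTh7) (hB17) : 4•[B11] − [Th7] − [B17] − 2•[PB7] ∈ KZ.relations — the nine-cell W₇-chart scissors congruence (7 cuts, 4 swaps, 4 inversions x ↦ 1/(7x) via W7_invert, linear cov); landed by census-1 g9 over the landed files #1/#2/#3 (copied prelude dropped, homonyms suffixed G, pins removed).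
Split by census-1 g9 `gen/splitlean.py`: scopes re-opened with their `open`/`variable`/`set_option` context; mathematics and declaration order unchanged. -/

set_option linter.unusedSimpArgs false
noncomputable section
open _root_.Set MvPolynomial
namespace Summit.KontsevichZagierPeriods.RootDecompQuadraticDescent.Pair18Homotopy
open Literature.NumberTheory.Transcendental
open Literature.NumberTheory.Transcendental.KZ (RFun cube)
open Summit.KontsevichZagierPeriods.RootDecompQuadraticDescent.DarkPairs (rel_reflect_rep rel_double)
section Fold
open Literature.ModelTheory.ExponentialFields (IsSemialgebraic isSemialgebraic_setOf_eval_le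
  isSemialgebraic_setOf_eval_pos isSemialgebraic_setOf_eval_nonneg isSemialgebraic_setOf_eval_eq_zero)

open Grid in
/-- (landing edit census-1 g9: `Grid.cutA`/`Grid.cutB` written qualified — the landed file #1 declares homonyms `Pair18Homotopy.cutA/cutB`.)
**hGrid from the two chart identifications** `hTh7 : [Th7] ≡ [W₇|□]`, `hB17 : [B17] ≡ [W₇|J₁²]`
(theorems `hTh7_holds`, `hB17_holds` of `Pair18HomotopyAng.lean`):
`4•[B11] - [Th7] - [B17] - 2•[PB7] ≡ 0`, i.e. `4(π/4)² = θ² + θ₁² + 2θθ₁`, `θ₁ = π/2 - θ`. -/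
theorem hGrid_of_charts (hTh7 : KZ.of Th7.rep - KZ.of W7cube ∈ KZ.relations)
    (hB17 : KZ.of B17.rep - KZ.of W7Sq17 ∈ KZ.relations) :
    4 • KZ.of B11.rep - KZ.of Th7.rep - KZ.of B17.rep - 2 • KZ.of PB7.rep ∈ KZ.relations := by
  have h := sub_mem (add_mem (add_mem (add_mem (sub_mem (sub_mem (sub_mem (sub_mem (sub_mem (sub_mem (sub_mem
    (sub_mem (sub_mem (sub_mem (sub_mem (sub_mem (sub_mem (sub_mem (nsmul_mem B11_Bsq 4) hTh7) hB17)
    (nsmul_mem PB7_C1 2)) Grid.cutA) cutKA) cutK3) swAJ3) (nsmul_mem ivJ3A 2)) ivJ33) swJ23) ivJ32)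
    (nsmul_mem cutC1 2)) (nsmul_mem swJ13 2)) (nsmul_mem ivJ31 2)) (nsmul_mem Grid.cutB 3)) cutJ1) cutJ2) swC21
  have e : 4 • KZ.of B11.rep - KZ.of Th7.rep - KZ.of B17.rep - 2 • KZ.of PB7.rep
      = 4 • (KZ.of B11.rep - KZ.of W7Bsq) - (KZ.of Th7.rep - KZ.of W7cube) - (KZ.of B17.rep - KZ.of W7Sq17)
        - 2 • (KZ.of PB7.rep - KZ.of W7C1)
        - (KZ.of W7cube - KZ.of W7KA - KZ.of W7K3) - (KZ.of W7KA - KZ.of W7Bsq - KZ.of W7AJ3)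
        - (KZ.of W7K3 - KZ.of W7J3A - KZ.of W7J33)
        - (KZ.of W7AJ3 - KZ.of W7J3A) - 2 • (KZ.of W7J3A - KZ.of W7J2A)
        - (KZ.of W7J33 - KZ.of W7J23) - (KZ.of W7J23 - KZ.of W7J32) - (KZ.of W7J32 - KZ.of W7C22)
        - 2 • (KZ.of W7C1 - KZ.of W7J1A - KZ.of W7J13) - 2 • (KZ.of W7J13 - KZ.of W7J31)
        - 2 • (KZ.of W7J31 - KZ.of W7C21)
        + 3 • (KZ.of W7Bsq - KZ.of W7J1A - KZ.of W7J2A) + (KZ.of W7J1A - KZ.of W7Sq17 - KZ.of W7C12)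
        + (KZ.of W7J2A - KZ.of W7C21 - KZ.of W7C22) - (KZ.of W7C21 - KZ.of W7C12) := by
    simp only [smul_sub]
    abel
  rw [e]; exact h

end Fold

end Summit.KontsevichZagierPeriods.RootDecompQuadraticDescent.Pair18Homotopy

end
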